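import Summits.CriticalPhenomena.PercolationContinuityZ3.Theorems.PercLowPointHalfSpaceTallClusterMassBoundTightnessEngineGlue

/-!
# Crux-triage r2 k=2 — evidence for idea `universal-tightness-volume-tail` (crux stmt-CriticalPhenomena-0912, B)

COSTUME CHECK at the engine level (rule (iv)). The card's two BULK engines for the residual C⁺
(`tallClusterMassBound_of_volumeTail`, `tallClusterMassBound_of_subcritGamma`, landed p111509 / p111492 /
glue `…TightnessEngineGlue.lean`) take as input

* (VT) a critical volume tail `P_{p_c}(|C(0)| ≥ n) ≤ C n^{-θ}` — the engine needs `θ > 1/11`;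
* (SG) a subcritical susceptibility bound `χ(p) ≤ C (p_c - p)^{-γ}` — the engine needs `1 ≤ γ < 20/11`.

Below: EACH input proves the summit conjunct `PercolationContinuityZ3` (`θ(p_c(ℤ³)) = 0`) outright, for
EVERY `θ > 0` resp. EVERY `γ < 2` (the side condition `1 ≤ γ` of the landed stub is carried, unused) —
i.e. on these two engines the line assumes strictly more than what the whole route is for
(round-1 panel standard: summit-closing residual input ⇒ costume). The card concedes this in prose
("recorded as the calibration of the lever"); here it is kernel-checked. The third (surface) engine's
input is NOT shown summit-closing (and is not believed to be: the Newman-type jump-world bound bites only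
if `γ₁ + 2κ < 2`).
-/

noncomputable section

open MeasureTheory Finset Filter Topology
open Literature.Probability.Percolation Literature.Probability.LatticeModels
open Summit.CriticalPhenomena.PercolationContinuityZ3.Theorems.TallClusterMassBound.Negative
open Summit.CriticalPhenomena.PercolationContinuityZ3.Theorems.TallClusterMassBound.TightnessLine

namespace Summit.CriticalPhenomena.PercolationContinuityZ3.Cruxes.TallClusterMassBound.TriageR2K2

/-- **(VT) closes the summit by itself**: a critical volume tail with ANY exponent `θ > 0` gives `θ(p_c) = 0`,
since `P_{p_c}(|C(0)| ≥ n) ↓ θ(p_c)` (`tendsto_real_clusterSizeGe`). [folklore] -/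
theorem continuity_of_volumeTail {θ C : ℝ} (hθ : 0 < θ)
    (hV : ∀ n : ℕ, 1 ≤ n → (Pp (criticalProbI 3)).real (clusterSizeGe (0 : V3) n) ≤ C * (n : ℝ) ^ (-θ)) :
    _root_.PercolationContinuityZ3 := by
  rw [_root_.PercolationContinuityZ3, percolationContinuityZ3_iff]
  have hlim : Tendsto (fun n : ℕ => (Pp (criticalProbI 3)).real (clusterSizeGe (0 : V3) n)) atTop
      (𝓝 (theta (zdGraph 3) (0 : V3) (criticalProbI 3))) :=
    tendsto_real_clusterSizeGe (zdGraph 3) (0 : V3) (criticalProbI 3)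
  have hup : Tendsto (fun n : ℕ => C * (n : ℝ) ^ (-θ)) atTop (𝓝 0) := by
    have h := ((tendsto_rpow_neg_atTop hθ).comp tendsto_natCast_atTop_atTop).const_mul C
    simpa using h
  have hle : theta (zdGraph 3) (0 : V3) (criticalProbI 3) ≤ 0 :=
    le_of_tendsto_of_tendsto hlim hup (eventually_atTop.2 ⟨1, fun n hn => hV n hn⟩)
  have hge : 0 ≤ theta (zdGraph 3) (0 : V3) (criticalProbI 3) := by
    unfold theta; exact measureReal_nonneg
  exact le_antisymm hle hge

/-- **(SG) closes the summit by itself**: a subcritical susceptibility exponent bound with ANY `γ < 2`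
gives `θ(p_c) = 0` — the landed KL engine `stub_klVolumeTail` (Hutchcroft 2022 Thm 1.3, tree) turns it into
(VT) with `θ = 1 - γ/2 > 0`. (Newman 1986: a jump forces `γ ≥ 2`.) [folklore] -/
theorem continuity_of_subcritGamma {γ C : ℝ} (hγ1 : 1 ≤ γ) (hγ2 : γ < 2)
    (hS : ∀ p : unitInterval, (p : ℝ) < criticalProb (zdGraph 3) (0 : V3) →
      chi 3 p ≤ C * (criticalProb (zdGraph 3) (0 : V3) - (p : ℝ)) ^ (-γ)) :
    _root_.PercolationContinuityZ3 := by
  obtain ⟨C', hC'⟩ := stub_klVolumeTail γ C hγ1 hγ2 hS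
  exact continuity_of_volumeTail (θ := 1 - γ / 2) (by linarith) hC'

/-- The B-engines' admissible ranges sit INSIDE the summit-closing ranges: `θ > 1/11 ⇒ θ > 0` and
`γ < 20/11 ⇒ γ < 2` — so (VT)/(SG) as used by the line are summit-closing a fortiori. [folklore] -/
theorem engine_ranges_inside : (∀ θ : ℝ, (1 : ℝ) / 11 < θ → 0 < θ) ∧ (∀ γ : ℝ, γ < (20 : ℝ) / 11 → γ < 2) :=
  ⟨fun θ h => by linarith, fun γ h => by linarith⟩

end Summit.CriticalPhenomena.PercolationContinuityZ3.Cruxes.TallClusterMassBound.TriageR2K2
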